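import Literature.NumberTheory.ConnesConsani2021.ArchKernelTier2Panels
import HarnessLib

/-!
# (E-a) Tier 2 — kernel reproduction of the panel data, group 7 (coarse panels 28..31)

RH-FREE certified-numerics plumbing (cell rh-crit, seat rh-crit-cc-iso g4).  `ArchKernelTier2Panels.lean` carries the
literal table `panelM` (2048 scaled sup bounds of `|2e_t·Re τ_c − S₈∘exp|` on the sub-panels of `[0, log 2]`) produced
by the interpreter; here the KERNEL recomputes coarse panels `28..31` (`panelSups combinedLit k`: the degree-6 stub S₈ Taylor
model from the landed K1 data, eng-1's degree-12 `sigmaTM k`, `shiftI` to 32 sub-panels, `tabsI`) and checks equality with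
the table — `decide +kernel` only (≈ 4 × 30 s), standard axioms.  The sixteen group files together give
`∀ k < 64, panelSups combinedLit k = some panelM[k]`, the input of the T2d soundness read-back (`tier2_hM`).
WHAT THIS IS NOT: a statement about the prolate functions or about RH; nothing here bears on the truth of RH.
-/

namespace Literature.NumberTheory.ConnesConsani2021.ArchCertT2

set_option maxRecDepth 200000 in
/-- **Panel group 7**: for `k ∈ [28, 29, 30, 31]` the kernel's `panelSups combinedLit k` IS row `k` of `panelM`. [cite: ConnesConsani2021, §6.4 Fact 6.1 + Lemma 6.3 p. 24 (in-kernel (E-a) certificate); §6.3 p. 24] -/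
theorem panels_eq_7 : ([28, 29, 30, 31].all
    (fun k ↦ decide (panelSups combinedLit k = some (panelM.getD k [])))) = true := by
  decide +kernel

end Literature.NumberTheory.ConnesConsani2021.ArchCertT2
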